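/-
Copyright: the b2b-balaban cell (near-miss cell 7), T⁴-continuum fan-out, lineage t4-ne7b-p1 (node U5c COUNT member).
Released under the licence of the surrounding project.
-/
import Summits.QuantumFields.BalabanUV.T4Continuum.Support.PlacementSkeleton

/-!
# Crowding roots (crowding theorem, part 1b): every merger is paid by the age of its younger root

Summits-side support leaf of the T⁴-continuum cell (rung (B)+1 on a FINITE torus only; NOT infinite volume, NOT the
mass gap, NOT the Clay statement; NOT a proof of the spine estimate NE7b).  Lineage `t4-ne7b-p1`, node U5c, wall (GM),
located item G-ne7bp1g18-2 part (II).  The placement exponent `partnerAges st G` of a binary genealogy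
(`T4PartnerMultiplicity.partnerAges`: at a merger `st e + 1 − max(rootStep X, rootStep Y)`, the age of the YOUNGER of
the two roots — the older one stays the root, `Gen.rootStep (merge X Y _) = min`) is here written as an explicit
MATCHING: the assignment `youngerRoot G : ε → ε` sends each merger event of `G` to the younger root at that merger; it
is INJECTIVE on the mergers, lands in the births other than the root of `G`, its value at a merger `e'` has step
`≤ st e' + 1` (order), and `Σ_{mergers e'} (st e' + 1 − st (youngerRoot G e')) = partnerAges st G` (steps consistent).
This is the [folklore] bookkeeping that lets the per-step YOUNGER-ROOT BUDGET of part 1 (`CrowdingBudget`, distinct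
`(age, class)` pairs sum superlinearly) be charged to `partnerAges`.  Generic in the event type `ε` and the step map
`st`; nothing is quoted from print; nothing printed is asserted; no `[cite:]` tag.

CONTENTS.  §1 `merges` (event-separation is read off `Gen.WF W`, any window table `W`); §2 `younger`, `youngerRoot`
and the properties `youngerRoot_mem_births` (with `≠ root`), `youngerRoot_injOn`, `st_youngerRoot_le`;
§3 `sum_age_youngerRoot` (the identity with `partnerAges`); §4 sanity.

HONEST DEPENDENCY (cell): continuum YM on T⁴ ⇐ BetaPertH ∧ nine spine estimates (0/9 proved); BetaPertH ⇐ (D1) ∧ (D4)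
∧ CAP+tail.  This file changes none of it.
-/

namespace Summit.QuantumFields.BalabanUV.T4Continuum.Crowding

open Finset
open Literature.MathematicalPhysics.QuantumFieldTheory.Balaban1983to89
open T4PersistenceDictionary T4PartnerMultiplicity
open Summit.QuantumFields.BalabanUV.T4Continuum.PlacementSkeleton

variable {ε : Type*} [DecidableEq ε]

/-! ## §1 Merger events and event-separation -/

/-- The MERGER EVENTS of a genealogy (one per `merge` node). [folklore] -/
def merges : Gen ε → Finset ε
  | Gen.born _ _ => ∅
  | Gen.renew G _ _ => merges G
  | Gen.merge X Y e => insert e (merges X ∪ merges Y)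

/-- merger events are events [folklore] -/
theorem merges_subset_events : ∀ G : Gen ε, merges G ⊆ G.events
  | Gen.born b j => by simp [merges]
  | Gen.renew G e h => fun x hx => by
      rw [Gen.events]
      exact mem_insert_of_mem (merges_subset_events G hx)
  | Gen.merge X Y e => fun x hx => by
      simp only [merges, mem_insert, mem_union] at hx
      rw [Gen.events, mem_insert, mem_union]
      rcases hx with h | h | h
      · exact Or.inl h
      · exact Or.inr (Or.inl (merges_subset_events X h))
      · exact Or.inr (Or.inr (merges_subset_events Y h))

/-! EVENT-SEPARATION is read off well-formedness `Gen.WF W` (any window table `W`): at every merger the two sides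
have disjoint events and the merger event is fresh (`PlacementSkeleton.separated_of_wf` gives the birth part). -/

variable (W : ε → ℕ)

/-! ## §2 The younger root of a merger and the matching -/

/-- The YOUNGER of the two roots at a merger of `X` with `Y` (the one that stops being a root; ties towards `Y`, matching
`Gen.root (merge X Y _) = X.root` on ties). [folklore] -/
def younger (X Y : Gen ε) : ε := if X.rootStep ≤ Y.rootStep then Y.root else X.root

/-- THE MATCHING `youngerRoot G`: a merger event of `G` ↦ the younger root at that merger (junk off the mergers).
[folklore] -/
def youngerRoot : Gen ε → ε → ε
  | Gen.born b _ => fun _ => b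
  | Gen.renew G _ _ => youngerRoot G
  | Gen.merge X Y e => fun e' =>
      if e' = e then younger X Y else if e' ∈ merges X then youngerRoot X e' else youngerRoot Y e'

/-- the two roots of a birth-separated merger differ [folklore] -/
theorem root_ne_root {X Y : Gen ε} (h : Disjoint (births X) (births Y)) : X.root ≠ Y.root := fun hXY =>
  disjoint_left.1 h (root_mem_births X) (hXY ▸ root_mem_births Y)

/-- On the mergers of `X`, the matching of `merge X Y e` is that of `X`. [folklore] -/
theorem youngerRoot_merge_left {X Y : Gen ε} {e e' : ε} (he : e ∉ merges X) (h' : e' ∈ merges X) :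
    youngerRoot (Gen.merge X Y e) e' = youngerRoot X e' := by
  have hne : e' ≠ e := fun h => he (h ▸ h')
  simp [youngerRoot, hne, h']

/-- On the mergers of `Y`, the matching of `merge X Y e` is that of `Y`. [folklore] -/
theorem youngerRoot_merge_right {X Y : Gen ε} {e e' : ε} (he : e ∉ merges Y) (hd : Disjoint (merges X) (merges Y))
    (h' : e' ∈ merges Y) : youngerRoot (Gen.merge X Y e) e' = youngerRoot Y e' := by
  have hne : e' ≠ e := fun h => he (h ▸ h')
  have hX : e' ∉ merges X := fun h => disjoint_left.1 hd h h'
  simp [youngerRoot, hne, hX]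

/-- At the merger event itself the matching is the younger root. [folklore] -/
theorem youngerRoot_merge_self (X Y : Gen ε) (e : ε) : youngerRoot (Gen.merge X Y e) e = younger X Y := by
  simp [youngerRoot]

/-- the separation facts used at a merger node, from well-formedness [folklore] -/
theorem merge_facts {X Y : Gen ε} {e : ε} (h : (Gen.merge X Y e).WF W) :
    e ∉ merges X ∧ e ∉ merges Y ∧ Disjoint (merges X) (merges Y) ∧ Disjoint (births X) (births Y) :=
  ⟨fun hx => h.2.2.1 (merges_subset_events X hx), fun hy => h.2.2.2.1 (merges_subset_events Y hy),
    h.2.2.2.2.1.mono (merges_subset_events X) (merges_subset_events Y),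
    h.2.2.2.2.1.mono (births_subset_events X) (births_subset_events Y)⟩

/-- **THE MATCHING LANDS IN THE NON-ROOT BIRTHS.** [folklore] -/
theorem youngerRoot_mem_births : ∀ {G : Gen ε}, G.WF W → ∀ e' ∈ merges G,
    youngerRoot G e' ∈ births G ∧ youngerRoot G e' ≠ G.root
  | Gen.born b j, _, e', he' => by simp [merges] at he'
  | Gen.renew G e h, hS, e', he' => by
      simpa [youngerRoot, births, Gen.root, merges] using youngerRoot_mem_births (G := G) hS.1 e' he'
  | Gen.merge X Y e, hS, e', he' => by
      obtain ⟨heX, heY, hdM, hdB⟩ := merge_facts W hS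
      have hXY := root_ne_root hdB
      simp only [merges, mem_insert, mem_union] at he'
      rw [births, show (Gen.merge X Y e).root = (if X.rootStep ≤ Y.rootStep then X.root else Y.root) from rfl]
      by_cases h1 : e' = e
      · subst h1
        rw [youngerRoot_merge_self, younger]
        by_cases hle : X.rootStep ≤ Y.rootStep
        · rw [if_pos hle, if_pos hle]
          exact ⟨mem_union_right _ (root_mem_births Y), hXY.symm⟩
        · rw [if_neg hle, if_neg hle]
          exact ⟨mem_union_left _ (root_mem_births X), hXY⟩
      · rcases he' with h | h | h
        · exact absurd h h1
        · rw [youngerRoot_merge_left heX h]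
          have ih := youngerRoot_mem_births hS.1 e' h
          refine ⟨mem_union_left _ ih.1, ?_⟩
          split_ifs
          · exact ih.2
          · exact fun hh => disjoint_left.1 hdB ih.1 (hh ▸ root_mem_births Y)
        · rw [youngerRoot_merge_right heY hdM h]
          have ih := youngerRoot_mem_births hS.2.1 e' h
          refine ⟨mem_union_right _ ih.1, ?_⟩
          split_ifs
          · exact fun hh => disjoint_left.1 hdB (hh ▸ root_mem_births X) ih.1
          · exact ih.2

/-- **THE MATCHING IS INJECTIVE ON THE MERGERS.** [folklore] -/
theorem youngerRoot_injOn : ∀ {G : Gen ε}, G.WF W → Set.InjOn (youngerRoot G) ↑(merges G)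
  | Gen.born b j, _ => by simp [merges]
  | Gen.renew G e h, hS => by simpa [youngerRoot, merges] using youngerRoot_injOn (G := G) hS.1
  | Gen.merge X Y e, hS => by
      obtain ⟨heX, heY, hdM, hdB⟩ := merge_facts W hS
      have vX : ∀ a ∈ merges X,
          youngerRoot (Gen.merge X Y e) a ∈ births X ∧ youngerRoot (Gen.merge X Y e) a ≠ X.root :=
        fun a ha => by rw [youngerRoot_merge_left heX ha]; exact youngerRoot_mem_births W hS.1 a ha
      have vY : ∀ a ∈ merges Y,
          youngerRoot (Gen.merge X Y e) a ∈ births Y ∧ youngerRoot (Gen.merge X Y e) a ≠ Y.root :=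
        fun a ha => by rw [youngerRoot_merge_right heY hdM ha]; exact youngerRoot_mem_births W hS.2.1 a ha
      have vE : youngerRoot (Gen.merge X Y e) e = X.root ∨ youngerRoot (Gen.merge X Y e) e = Y.root := by
        rw [youngerRoot_merge_self, younger]
        split_ifs
        · exact Or.inr rfl
        · exact Or.inl rfl
      have key : ∀ a ∈ merges X ∪ merges Y, youngerRoot (Gen.merge X Y e) a ≠ youngerRoot (Gen.merge X Y e) e := by
        intro a ha hae
        rcases mem_union.1 ha with ha | ha
        · rcases vE with hv | hv
          · exact (vX a ha).2 (hae.trans hv)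
          · exact disjoint_left.1 hdB (vX a ha).1 ((hae.trans hv) ▸ root_mem_births Y)
        · rcases vE with hv | hv
          · exact disjoint_left.1 hdB ((hae.trans hv) ▸ root_mem_births X) (vY a ha).1
          · exact (vY a ha).2 (hae.trans hv)
      intro a ha a' ha' h
      rw [mem_coe] at ha ha'
      simp only [merges, mem_insert] at ha ha'
      rcases ha with rfl | ha
      · rcases ha' with rfl | ha'
        · rfl
        · exact absurd h.symm (key a' ha')
      · rcases ha' with rfl | ha'
        · exact absurd h (key a ha)
        · rcases mem_union.1 ha with ha | ha <;> rcases mem_union.1 ha' with ha' | ha'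
          · rw [youngerRoot_merge_left heX ha, youngerRoot_merge_left heX ha'] at h
            exact youngerRoot_injOn hS.1 (mem_coe.2 ha) (mem_coe.2 ha') h
          · exact absurd (vX a ha).1 (fun hh => disjoint_left.1 hdB hh (h ▸ (vY a' ha').1))
          · exact absurd (vY a ha).1 (fun hh => disjoint_left.1 hdB (h ▸ (vX a' ha').1) hh)
          · rw [youngerRoot_merge_right heY hdM ha, youngerRoot_merge_right heY hdM ha'] at h
            exact youngerRoot_injOn hS.2.1 (mem_coe.2 ha) (mem_coe.2 ha') h

omit [DecidableEq ε] in
/-- the step of the younger root is the later root step [folklore] -/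
theorem st_younger (st : ε → ℕ) {X Y : Gen ε} (hX : StepsOK st X) (hY : StepsOK st Y) :
    st (younger X Y) = max X.rootStep Y.rootStep := by
  rw [younger]
  split_ifs with h
  · rw [← rootStep_eq_st_root st hY, max_eq_right h]
  · rw [← rootStep_eq_st_root st hX, max_eq_left (le_of_lt (not_le.1 h))]

/-- **ORDER.**  The younger root at a merger `e'` is born no later than `st e' + 1`. [folklore] -/
theorem st_youngerRoot_le (st : ε → ℕ) : ∀ {G : Gen ε}, G.WF W → StepsOK st G → Ordered st G →
    ∀ e' ∈ merges G, st (youngerRoot G e') ≤ st e' + 1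
  | Gen.born b j, _, _, _, e', he' => by simp [merges] at he'
  | Gen.renew G e h, hE, hS, hO, e', he' => st_youngerRoot_le st (G := G) hE.1 hS hO e' he'
  | Gen.merge X Y e, hE, hS, hO, e', he' => by
      obtain ⟨heX, heY, hdM, -⟩ := merge_facts W hE
      simp only [merges, mem_insert, mem_union] at he'
      rcases he' with rfl | h | h
      · rw [youngerRoot_merge_self, st_younger st hS.1 hS.2]
        exact max_le hO.2.2.1 hO.2.2.2
      · rw [youngerRoot_merge_left heX h]
        exact st_youngerRoot_le st hE.1 hS.1 hO.1 e' h
      · rw [youngerRoot_merge_right heY hdM h]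
        exact st_youngerRoot_le st hE.2.1 hS.2 hO.2.1 e' h

/-! ## §3 The ages of the younger roots sum to `partnerAges` -/

/-- **THE IDENTITY.**  `Σ_{mergers e'} (st e' + 1 − st (youngerRoot G e')) = partnerAges st G` (event-separated,
steps consistent; truncated subtraction as in `partnerAges`). [folklore] -/
theorem sum_age_youngerRoot (st : ε → ℕ) : ∀ {G : Gen ε}, G.WF W → StepsOK st G →
    ∑ e' ∈ merges G, (st e' + 1 - st (youngerRoot G e')) = partnerAges st G
  | Gen.born b j, _, _ => by simp [merges, partnerAges]
  | Gen.renew G e h, hE, hS => by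
      simpa [merges, youngerRoot, partnerAges] using sum_age_youngerRoot st (G := G) hE.1 hS
  | Gen.merge X Y e, hE, hS => by
      obtain ⟨heX, heY, hdM, -⟩ := merge_facts W hE
      have hXY : e ∉ merges X ∪ merges Y := by simp [heX, heY]
      have hcX : ∑ a ∈ merges X, (st a + 1 - st (youngerRoot (Gen.merge X Y e) a)) =
          ∑ a ∈ merges X, (st a + 1 - st (youngerRoot X a)) :=
        sum_congr rfl fun a ha => by rw [youngerRoot_merge_left heX ha]
      have hcY : ∑ a ∈ merges Y, (st a + 1 - st (youngerRoot (Gen.merge X Y e) a)) =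
          ∑ a ∈ merges Y, (st a + 1 - st (youngerRoot Y a)) :=
        sum_congr rfl fun a ha => by rw [youngerRoot_merge_right heY hdM ha]
      rw [merges, sum_insert hXY, sum_union hdM, hcX, hcY, sum_age_youngerRoot st hE.1 hS.1,
        sum_age_youngerRoot st hE.2.1 hS.2, partnerAges, youngerRoot_merge_self, st_younger st hS.1 hS.2]
      ring

/-! ## §4 Sanity (decided instances; not used elsewhere) -/

namespace Sanity

/-- two births `0` (step 0) and `1` (step 3) merged by event `2`: the younger root is `1` -/
theorem example_younger :
    youngerRoot (Gen.merge (Gen.born (0 : ℕ) 0) (Gen.born 1 3) 2) 2 = 1 := by decide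

/-- and the merged genealogy's mergers are `{2}` -/
theorem example_merges : merges (Gen.merge (Gen.born (0 : ℕ) 0) (Gen.born 1 3) 2) = {2} := by decide

end Sanity

end Summit.QuantumFields.BalabanUV.T4Continuum.Crowding
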